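import Summits.AtomisticToContinuum.HydrodynamicLimit.Theorems.InformationPercolationEngineLocalSecondLawInitialMatchingTV
import Mathlib.Probability.Moments.Variance

/-!
# Stub B′|ML (`stub_initialMatchingOfStatics`) of the line `contact-asymmetry-information` for the crux `LocalSecondLaw`
(stmt-AtomisticToContinuum-13081) — part 4a: the conditional `L²` size of peculiar-energy fluctuations under the local Gibbs law

The reduced peculiar energy of a particle, `q(y, v) = |v − u₀(y)|²/(2θ₀(y))`, has conditional mean `3/2` and a conditional
variance bounded by the absolute constant `B = K/4`, `K = E(|w|² − 3)²` (standard Gaussian on `ℝ³`), under the local Maxwellian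
`N(u₀(y), θ₀(y)𝟙)` — uniformly in the position.  Since, under the local Gibbs measure, the velocities are conditionally
independent Gaussians given the positions (`lintegral_localGibbsMeasure`), the weighted empirical fluctuation
`A(z) = (N+1)⁻¹ Σᵢ a(xᵢ)(q(xᵢ,vᵢ) − 3/2)` with ANY measurable weight `|a| ≤ 1` satisfies

  `E_{P_N} A² ≤ B/(N+1)`   (`en_lintegral_fluct_sq_le`, stated as a bound on `∫⁻ ofReal(A²)`),

the `L²` form of the tree's `localGibbsMeasure_velFluct_le` (which is the Chebyshev tail form), by Bienaymé
(`ProbabilityTheory.variance_sum_pi`) inside the disintegration.  Part 4b turns this into the peculiar-energy matching of every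
bounded tilt `P_N(·|S)` (conditioning moves `E A` by at most `δ″⁻¹ √(E A²)`).

References: H. Spohn, *Large Scale Dynamics of Interacting Particles* (1991), Part I §2.3; I. Csiszár, Ann. Probab. 3 (1975)
146–158.  Lead c16 (prover-line-stmt-AtomisticToContinuum-13081-c16-0).
-/

noncomputable section

open scoped BigOperators Topology Classical MeasureTheory ENNReal InnerProductSpace
open Filter Set MeasureTheory Function ProbabilityTheory
open Literature.MathematicalPhysics.KineticTheory
open Literature.Analysis.FluidPDE
open Summit.AtomisticToContinuum.HydrodynamicLimit.Theorems.LocalSecondLawNegative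
open Summit.AtomisticToContinuum.HydrodynamicLimit.Theorems.LocalSecondLawLedger
open Summit.AtomisticToContinuum.HydrodynamicLimit.Theorems.LocalSecondLawContact

namespace Summit.AtomisticToContinuum.HydrodynamicLimit.Theorems.LocalSecondLawInitialMatching

/-! ### The reduced peculiar energy under a local Maxwellian -/

/-- The centred reduced peculiar energy after the Gaussian shift: `|u + √θ w − u|²/(2θ) − 3/2 = (|w|² − 3)/2`. -/
theorem en_shift_eq {θ : ℝ} (hθ : 0 < θ) (u w : V3) :
    ‖(u + Real.sqrt θ • w) - u‖ ^ 2 / (2 * θ) - 3 / 2 = (‖w‖ ^ 2 - 3) / 2 := by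
  rw [add_sub_cancel_left, norm_smul, Real.norm_eq_abs, abs_of_nonneg (Real.sqrt_nonneg θ), mul_pow,
    Real.sq_sqrt hθ.le]
  field_simp

/-- **Moments of the reduced peculiar energy**: under `N(u, θ𝟙)` (`θ > 0`) the variable `Y(v) = |v − u|²/(2θ) − 3/2` is in `L²`,
centred, and `Var Y ≤ K/4`, `K = gaussFourthMomentConst (Fin 3)` — uniformly in `(u, θ)`. -/
theorem en_peculiar_moments {θ : ℝ} (hθ : 0 < θ) (u : V3) :
    MemLp (fun v : V3 => ‖v - u‖ ^ 2 / (2 * θ) - 3 / 2) 2 (gaussMeasure u θ) ∧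
      ∫ v, (‖v - u‖ ^ 2 / (2 * θ) - 3 / 2) ∂(gaussMeasure u θ) = 0 ∧
      Var[fun v : V3 => ‖v - u‖ ^ 2 / (2 * θ) - 3 / 2; gaussMeasure u θ] ≤ gaussFourthMomentConst (Fin 3) / 4 := by
  set Y : V3 → ℝ := fun v => ‖v - u‖ ^ 2 / (2 * θ) - 3 / 2 with hY
  have hYc : Continuous Y := by rw [hY]; fun_prop
  have hcomp : Y ∘ (gaussShiftEquiv u hθ) = fun w : V3 => (‖w‖ ^ 2 - 3) / 2 := by
    funext w
    rw [Function.comp_apply, coe_gaussShiftEquiv]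
    exact en_shift_eq hθ u w
  have hcard : (Fintype.card (Fin 3) : ℝ) = 3 := by simp
  -- `L²`
  have hmem0 : MemLp (fun w : V3 => (‖w‖ ^ 2 - 3) / 2) 2 (stdGaussian V3) := by
    rw [memLp_two_iff_integrable_sq (by fun_prop)]
    have h := (integrable_norm_sq_sub_card_sq (ι := Fin 3)).div_const 4
    rw [hcard] at h
    refine h.congr (ae_of_all _ fun w => ?_)
    show (‖w‖ ^ 2 - 3) ^ 2 / 4 = ((‖w‖ ^ 2 - 3) / 2) ^ 2
    ring
  have hmem : MemLp Y 2 (gaussMeasure u θ) := by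
    rw [gaussMeasure, ← coe_gaussShiftEquiv u hθ, MeasurableEquiv.memLp_map_measure_iff, hcomp]
    exact hmem0
  -- centred
  have hmean : ∫ v, Y v ∂(gaussMeasure u θ) = 0 := by
    rw [integral_gaussMeasure u hθ]
    have h1 : (fun w : V3 => Y (u + Real.sqrt θ • w)) = fun w => (‖w‖ ^ 2 - 3) / 2 := by
      funext w; exact en_shift_eq hθ u w
    rw [h1, integral_div, integral_sub (integrable_norm_sq_stdGaussian) (integrable_const _),
      integral_norm_sq_stdGaussian, integral_const, probReal_univ, one_smul, hcard]
    norm_num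
  -- variance
  have hvar : Var[Y; gaussMeasure u θ] ≤ gaussFourthMomentConst (Fin 3) / 4 := by
    rw [variance_eq_integral hmem.aestronglyMeasurable.aemeasurable, hmean]
    simp only [sub_zero]
    rw [integral_gaussMeasure u hθ]
    have h1 : (fun w : V3 => Y (u + Real.sqrt θ • w) ^ 2) = fun w => (‖w‖ ^ 2 - Fintype.card (Fin 3)) ^ 2 / 4 := by
      funext w
      show (‖(u + Real.sqrt θ • w) - u‖ ^ 2 / (2 * θ) - 3 / 2) ^ 2 = _
      rw [en_shift_eq hθ u w, hcard]; ring
    rw [h1, integral_div, gaussFourthMomentConst]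
  exact ⟨hmem, hmean, hvar⟩

/-! ### The conditional `L²` size of a weighted empirical fluctuation -/

/-- Bienaymé for a weighted average of independent centred variables on a product of probability spaces:
`E ((n⁻¹ Σᵢ aᵢ Xᵢ(vᵢ))²) ≤ B/n` when `|aᵢ| ≤ 1`, `E Xᵢ = 0`, `Var Xᵢ ≤ B`. -/
theorem en_pi_integral_avg_sq_le {n : ℕ} (hn : 0 < n) (μ : Fin n → Measure V3) [∀ i, IsProbabilityMeasure (μ i)]
    (X : Fin n → V3 → ℝ) (hX : ∀ i, MemLp (X i) 2 (μ i)) (h0 : ∀ i, ∫ v, X i v ∂μ i = 0)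
    {B : ℝ} (hB : ∀ i, Var[X i; μ i] ≤ B) (a : Fin n → ℝ) (ha : ∀ i, |a i| ≤ 1) :
    Integrable (fun v : Fin n → V3 => ((n : ℝ)⁻¹ * ∑ i, a i * X i (v i)) ^ 2) (Measure.pi μ) ∧
      ∫ v, ((n : ℝ)⁻¹ * ∑ i, a i * X i (v i)) ^ 2 ∂(Measure.pi μ) ≤ B / n := by
  have hnpos : (0 : ℝ) < n := by exact_mod_cast hn
  set Z : Fin n → V3 → ℝ := fun i v => a i * X i v with hZ
  have hZm : ∀ i, MemLp (Z i) 2 (μ i) := fun i => (hX i).const_mul _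
  set S : (Fin n → V3) → ℝ := ∑ i, fun v => Z i (v i) with hS
  have hSi : ∀ i, MemLp (fun v : Fin n → V3 => Z i (v i)) 2 (Measure.pi μ) := fun i =>
    (hZm i).comp_measurePreserving (measurePreserving_eval μ i)
  have hSm : MemLp S 2 (Measure.pi μ) := memLp_finsetSum' _ fun i _ => hSi i
  have hSapply : ∀ v, S v = ∑ i, a i * X i (v i) := fun v => by simp [hS, hZ]
  have hmean_i : ∀ i, ∫ v, Z i (v i) ∂Measure.pi μ = 0 := by
    intro i
    have h := integral_map (μ := Measure.pi μ) (measurable_pi_apply i).aemeasurable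
      (f := Z i) (by rw [(measurePreserving_eval μ i).map_eq]; exact (hZm i).aestronglyMeasurable)
    rw [(measurePreserving_eval μ i).map_eq] at h
    rw [← h]
    show ∫ y, a i * X i y ∂μ i = 0
    rw [integral_const_mul, h0 i, mul_zero]
  have hmean : ∫ v, S v ∂Measure.pi μ = 0 := by
    simp_rw [hSapply]
    rw [integral_finsetSum _ fun i _ => (hSi i).integrable one_le_two]
    exact Finset.sum_eq_zero fun i _ => hmean_i i
  have hvar : Var[S; Measure.pi μ] ≤ n * B := by
    rw [hS, variance_sum_pi hZm]
    calc ∑ i, Var[Z i; μ i] ≤ ∑ _i : Fin n, B := Finset.sum_le_sum fun i _ => by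
            show Var[fun v => a i * X i v; μ i] ≤ B
            rw [variance_const_mul]
            have hB0 : 0 ≤ Var[X i; μ i] := variance_nonneg _ _
            have ha2 : a i ^ 2 ≤ 1 := by
              have := ha i
              rw [abs_le] at this
              nlinarith
            nlinarith [hB i]
      _ = n * B := by simp
  -- `E S² = Var S`
  have hS2 : ∫ v, S v ^ 2 ∂Measure.pi μ = Var[S; Measure.pi μ] := by
    rw [variance_eq_integral hSm.aestronglyMeasurable.aemeasurable, hmean]
    simp
  have hint : Integrable (fun v => S v ^ 2) (Measure.pi μ) := hSm.integrable_sq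
  constructor
  · refine (hint.const_mul ((n : ℝ)⁻¹ ^ 2)).congr (ae_of_all _ fun v => ?_)
    show (n : ℝ)⁻¹ ^ 2 * S v ^ 2 = ((n : ℝ)⁻¹ * ∑ i, a i * X i (v i)) ^ 2
    rw [hSapply]; ring
  · have h1 : ∫ v, ((n : ℝ)⁻¹ * ∑ i, a i * X i (v i)) ^ 2 ∂(Measure.pi μ) = (n : ℝ)⁻¹ ^ 2 * ∫ v, S v ^ 2 ∂Measure.pi μ := by
      rw [← integral_const_mul]
      refine integral_congr_ae (ae_of_all _ fun v => ?_)
      show ((n : ℝ)⁻¹ * ∑ i, a i * X i (v i)) ^ 2 = (n : ℝ)⁻¹ ^ 2 * S v ^ 2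
      rw [hSapply]; ring
    rw [h1, hS2]
    calc (n : ℝ)⁻¹ ^ 2 * Var[S; Measure.pi μ] ≤ (n : ℝ)⁻¹ ^ 2 * (n * B) :=
          mul_le_mul_of_nonneg_left hvar (by positivity)
      _ = B / n := by field_simp

/-- **Conditional `L²` bound for weighted peculiar-energy fluctuations under the local Gibbs measure.**  For continuous
profiles (`θ₀ > 0`), a measurable weight `a : 𝕋³ → ℝ` with `|a| ≤ 1`, and `q(y,v) = |v − u₀(y)|²/(2θ₀(y))`:
`∫⁻ ofReal ( ((N+1)⁻¹ Σᵢ a(xᵢ)(q(xᵢ,vᵢ) − 3/2))² ) dP_N ≤ ofReal (K/(4(N+1)))`, `K = gaussFourthMomentConst (Fin 3)`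
(disintegration: given the positions the velocities are independent `N(u₀(xᵢ), θ₀(xᵢ)𝟙)`; Bienaymé). -/
theorem en_lintegral_fluct_sq_le : ∀ {a₀ θ₀ : T3 → ℝ} {u₀ : T3 → V3}, Continuous a₀ → Continuous θ₀ → Continuous u₀ → (∀ x, 0 ≤ a₀ x) → (∀ x, 0 < θ₀ x) → ∀ (σ : ℝ) (N : ℕ) [IsProbabilityMeasure (localGibbsMeasure σ a₀ u₀ θ₀ N)] {a : T3 → ℝ}, Measurable a → (∀ y, |a y| ≤ 1) → ∫⁻ z, ENNReal.ofReal ((((N + 1 : ℕ) : ℝ)⁻¹ * ∑ i, a (z i).1 * (‖(z i).2 - u₀ (z i).1‖ ^ 2 / (2 * θ₀ (z i).1) - 3 / 2)) ^ 2) ∂(localGibbsMeasure σ a₀ u₀ θ₀ N) ≤ ENNReal.ofReal (gaussFourthMomentConst (Fin 3) / 4 / (N + 1 : ℕ)) := by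
  intro a₀ θ₀ u₀ ha hθ hu ha0 hθ0 σ N _ a ham ha1
  set B : ℝ := gaussFourthMomentConst (Fin 3) / 4 with hB
  set Y : T3 → V3 → ℝ := fun y v => ‖v - u₀ y‖ ^ 2 / (2 * θ₀ y) - 3 / 2 with hY
  have hYm : Measurable fun p : T3 × V3 => Y p.1 p.2 := by
    rw [hY]
    exact (((measurable_snd.sub (hu.measurable.comp measurable_fst)).norm.pow_const 2).div
      ((hθ.measurable.comp measurable_fst).const_mul 2)).sub measurable_const
  set F : Config (N + 1) (Fin 3) T3 → ℝ := fun z =>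
    (((N + 1 : ℕ) : ℝ)⁻¹ * ∑ i, a (z i).1 * Y (z i).1 (z i).2) ^ 2 with hF
  have hFm : Measurable F := by
    refine (measurable_const.mul (Finset.measurable_sum _ fun i _ => ?_)).pow_const 2
    exact (ham.comp (measurable_pi_apply i).fst).mul (hYm.comp (measurable_pi_apply i))
  have hG : Measurable fun z => ENNReal.ofReal (F z) := hFm.ennreal_ofReal
  show ∫⁻ z, ENNReal.ofReal (F z) ∂(localGibbsMeasure σ a₀ u₀ θ₀ N) ≤ ENNReal.ofReal (B / (N + 1 : ℕ))
  rw [lintegral_localGibbsMeasure ha hθ hu ha0 hθ0 σ N hG]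
  -- the conditional bound, uniformly in the positions
  have hvel : ∀ x : Fin (N + 1) → T3,
      ∫⁻ v, ENNReal.ofReal (F (zipConfig (x, v))) ∂(velMeasure u₀ θ₀ x) ≤ ENNReal.ofReal (B / (N + 1 : ℕ)) := by
    intro x
    have hmom := fun i : Fin (N + 1) => en_peculiar_moments (hθ0 (x i)) (u₀ (x i))
    obtain ⟨hint, hle⟩ := en_pi_integral_avg_sq_le (Nat.succ_pos N)
      (fun i => gaussMeasure (u₀ (x i)) (θ₀ (x i))) (fun i => Y (x i)) (fun i => (hmom i).1)
      (fun i => (hmom i).2.1) (B := B) (fun i => (hmom i).2.2) (fun i => a (x i)) (fun i => ha1 (x i))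
    have hF' : ∀ v : Fin (N + 1) → V3, F (zipConfig (x, v)) =
        ((((N + 1 : ℕ) : ℝ))⁻¹ * ∑ i, a (x i) * Y (x i) (v i)) ^ 2 := by
      intro v; simp only [hF, zipConfig_apply]
    unfold velMeasure
    simp_rw [hF']
    rw [← ofReal_integral_eq_lintegral_ofReal hint (ae_of_all _ fun v => sq_nonneg _)]
    exact ENNReal.ofReal_le_ofReal (by exact_mod_cast hle)
  calc ∫⁻ x, ENNReal.ofReal ((canonicalPartition (Torus.geometry (Fin 3)) (hsDiameter σ N) (N + 1)
          (localGibbsProfile a₀ u₀ θ₀))⁻¹ * posWeight a₀ (hsDiameter σ N) (N + 1) x) *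
          ∫⁻ v, ENNReal.ofReal (F (zipConfig (x, v))) ∂(velMeasure u₀ θ₀ x)
      ≤ ∫⁻ x, ENNReal.ofReal ((canonicalPartition (Torus.geometry (Fin 3)) (hsDiameter σ N) (N + 1)
          (localGibbsProfile a₀ u₀ θ₀))⁻¹ * posWeight a₀ (hsDiameter σ N) (N + 1) x) * ENNReal.ofReal (B / (N + 1 : ℕ)) :=
        lintegral_mono fun x => mul_le_mul_right (hvel x) _
    _ = ENNReal.ofReal (B / (N + 1 : ℕ)) := by
        rw [lintegral_mul_const' _ _ ENNReal.ofReal_ne_top, lintegral_posWeight_eq_one ha hθ hu ha0 hθ0 σ N, one_mul]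

end Summit.AtomisticToContinuum.HydrodynamicLimit.Theorems.LocalSecondLawInitialMatching

end
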